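import Literature.Analysis.FluidPDE.TaoEnergyLocalisationProofs
import Summits.NavierStokesRegularity.NavierStokesRegularity.Theorems.TypeICertificateLadderTargetStrainCubeCalculus
import Summits.NavierStokesRegularity.NavierStokesRegularity.Theorems.TypeICertificateLadderRungReynoldsOneWeightedSliceTools
import HarnessLib

/-!
# Crux `Target` = `TypeICertificateLadder.NoTypeIBlowup` (stmt-NavierStokesRegularity-1217), line
# `depletion-ladder`: SIZES OF THE STRAIN AND THE POINTWISE STEP OF THE CUBE INTERPOLATION

`--supports stmt-NavierStokesRegularity-1217` (third file of the seat's proof of the depletion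
constant `κ = (√3+√6)/9 < 1/2` in the Tao-slice class, hence RUNG TWO of the amplitude ladder).

For a smooth divergence-free `v : ℝ³ → ℝ³`, strain `sᵢⱼ = ½(∂ⱼvᵢ + ∂ᵢvⱼ)`, `q = Σᵢⱼ sᵢⱼ²`,
`D = Σₗᵢⱼ (∂ₗsᵢⱼ)²` and a differentiable weight `N` (the regularised modulus of the previous file):

* sizes: `|sᵢⱼ| ≤ ‖D¹v‖`, `q ≤ 9‖D¹v‖²`, `|∂ₗsᵢⱼ| ≤ ‖D²v‖`, `D ≤ 27‖D²v‖²`, `‖Δv‖ ≤ 6‖D²v‖`,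
  continuity of `Δv`;
* `sum_pderiv_mul_weight_eq` — the pointwise splitting
  `Σᵢⱼ ∂ⱼ(sᵢⱼN) vᵢ = N Σᵢ vᵢ (½(Δv)ᵢ) + Σᵢ vᵢ Σⱼ sᵢⱼ ∂ⱼN` (`Σⱼ∂ⱼsᵢⱼ = ½(Δv)ᵢ`);
* `neg_sum_pderiv_mul_weight_le` — its bound `≤ M (½ N‖Δv‖ + √q √D)` when `|v| ≤ M`, `0 ≤ N`,
  `Σⱼ(∂ⱼN)² ≤ D`.

The integration (by parts, Cauchy–Schwarz, `ε`-removal) giving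
`∫ q√q ≤ M(½‖Δv‖₂√(∫q) + √(∫q)√(∫D))` is the sequel file. WHAT THIS IS NOT: pointwise only.
[folklore]
-/

noncomputable section

open Set Function Filter Topology MeasureTheory Finset
open scoped RealInnerProductSpace ENNReal NNReal Laplacian ContDiff
open Literature.Analysis.FluidPDE

namespace Summit.NavierStokesRegularity.NavierStokesRegularity.Theorems.DepletionLadder.StrainCube

-- the problem directory repeats the summit name (`NavierStokesRegularity/NavierStokesRegularity`)
set_option linter.dupNamespace false

variable {v : EuclideanSpace ℝ (Fin 3) → EuclideanSpace ℝ (Fin 3)}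
  {s : Fin 3 → Fin 3 → EuclideanSpace ℝ (Fin 3) → ℝ}

/-! ## Pointwise size of the strain, its gradient and the Laplacian -/

/-- `sᵢⱼ` is smooth. [folklore] -/
theorem contDiff_sym (hv : ContDiff ℝ ∞ v)
    (hs : ∀ i j y, s i j y = (pderiv j (fun z => v z i) y + pderiv i (fun z => v z j) y) / 2)
    (i j : Fin 3) : ContDiff ℝ ∞ (s i j) := by
  have h : s i j = fun y => (pderiv j (fun z => v z i) y + pderiv i (fun z => v z j) y) / 2 :=
    funext (hs i j)
  rw [h]
  exact ((contDiff_grad hv i j).add (contDiff_grad hv j i)).div_const _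

/-- `|sᵢⱼ(x)| ≤ ‖D¹v(x)‖`. [folklore] -/
theorem abs_sym_le (hv : ContDiff ℝ ∞ v)
    (hs : ∀ i j y, s i j y = (pderiv j (fun z => v z i) y + pderiv i (fun z => v z j) y) / 2)
    (i j : Fin 3) (x : EuclideanSpace ℝ (Fin 3)) : |s i j x| ≤ ‖iteratedFDeriv ℝ 1 v x‖ := by
  rw [hs, ← norm_fderiv_eq_norm_iteratedFDeriv_one]
  have h1 := abs_grad_le_norm_fderiv hv i j x
  have h2 := abs_grad_le_norm_fderiv hv j i x
  rw [abs_le] at h1 h2 ⊢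
  constructor <;> linarith [h1.1, h1.2, h2.1, h2.2]

/-- `q = Σ sᵢⱼ² ≤ 9 ‖D¹v‖²`. [folklore] -/
theorem sumSq_sym_le (hv : ContDiff ℝ ∞ v)
    (hs : ∀ i j y, s i j y = (pderiv j (fun z => v z i) y + pderiv i (fun z => v z j) y) / 2)
    (x : EuclideanSpace ℝ (Fin 3)) : ∑ i, ∑ j, s i j x ^ 2 ≤ 9 * ‖iteratedFDeriv ℝ 1 v x‖ ^ 2 := by
  have h : ∀ i j, s i j x ^ 2 ≤ ‖iteratedFDeriv ℝ 1 v x‖ ^ 2 := fun i j => by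
    rw [← sq_abs]; exact pow_le_pow_left₀ (abs_nonneg _) (abs_sym_le hv hs i j x) 2
  calc ∑ i, ∑ j, s i j x ^ 2 ≤ ∑ _i : Fin 3, ∑ _j : Fin 3, ‖iteratedFDeriv ℝ 1 v x‖ ^ 2 :=
        sum_le_sum fun i _ => sum_le_sum fun j _ => h i j
    _ = 9 * ‖iteratedFDeriv ℝ 1 v x‖ ^ 2 := by simp; ring

/-- `√q ≤ 3 ‖D¹v‖`. [folklore] -/
theorem sqrt_sumSq_sym_le (hv : ContDiff ℝ ∞ v)
    (hs : ∀ i j y, s i j y = (pderiv j (fun z => v z i) y + pderiv i (fun z => v z j) y) / 2)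
    (x : EuclideanSpace ℝ (Fin 3)) : Real.sqrt (∑ i, ∑ j, s i j x ^ 2) ≤ 3 * ‖iteratedFDeriv ℝ 1 v x‖ := by
  calc Real.sqrt (∑ i, ∑ j, s i j x ^ 2) ≤ Real.sqrt ((3 * ‖iteratedFDeriv ℝ 1 v x‖) ^ 2) :=
        Real.sqrt_le_sqrt (by nlinarith [sumSq_sym_le hv hs x])
    _ = 3 * ‖iteratedFDeriv ℝ 1 v x‖ := Real.sqrt_sq (by positivity)

/-- `∂ₗ sᵢⱼ = ½(∂ₗ∂ⱼvᵢ + ∂ₗ∂ᵢvⱼ)`. [folklore] -/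
theorem pderiv_sym_eq (hv : ContDiff ℝ ∞ v)
    (hs : ∀ i j y, s i j y = (pderiv j (fun z => v z i) y + pderiv i (fun z => v z j) y) / 2)
    (l i j : Fin 3) (x : EuclideanSpace ℝ (Fin 3)) : pderiv l (s i j) x =
      (pderiv l (pderiv j fun z => v z i) x + pderiv l (pderiv i fun z => v z j) x) / 2 := by
  have h : s i j = fun y => (pderiv j (fun z => v z i) y + pderiv i (fun z => v z j) y) / 2 :=
    funext (hs i j)
  have hd : ∀ i j, Differentiable ℝ (pderiv j fun z => v z i) :=
    fun i j => (contDiff_grad hv i j).differentiable (by simp)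
  rw [h]
  have hfun : (fun y => (pderiv j (fun z => v z i) y + pderiv i (fun z => v z j) y) / 2) =
      fun y => (1 / 2 : ℝ) * (pderiv j (fun z => v z i) y + pderiv i (fun z => v z j) y) := by
    funext y; ring
  rw [hfun, pderiv_const_mul (f := fun y => pderiv j (fun z => v z i) y + pderiv i (fun z => v z j) y)
    ((hd i j).add (hd j i)), pderiv_add (hd i j) (hd j i)]
  ring

/-- `|∂ₗ sᵢⱼ(x)| ≤ ‖D²v(x)‖`. [folklore] -/
theorem abs_pderiv_sym_le (hv : ContDiff ℝ ∞ v)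
    (hs : ∀ i j y, s i j y = (pderiv j (fun z => v z i) y + pderiv i (fun z => v z j) y) / 2)
    (l i j : Fin 3) (x : EuclideanSpace ℝ (Fin 3)) : |pderiv l (s i j) x| ≤ ‖iteratedFDeriv ℝ 2 v x‖ := by
  rw [pderiv_sym_eq hv hs]
  have h1 := abs_pderiv_grad_le hv i j l x
  have h2 := abs_pderiv_grad_le hv j i l x
  rw [abs_le] at h1 h2 ⊢
  constructor <;> linarith [h1.1, h1.2, h2.1, h2.2]

/-- `D = Σₗᵢⱼ (∂ₗ sᵢⱼ)² ≤ 27 ‖D²v‖²`. [folklore] -/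
theorem gradSq_sym_le (hv : ContDiff ℝ ∞ v)
    (hs : ∀ i j y, s i j y = (pderiv j (fun z => v z i) y + pderiv i (fun z => v z j) y) / 2)
    (x : EuclideanSpace ℝ (Fin 3)) :
    ∑ l, ∑ i, ∑ j, pderiv l (s i j) x ^ 2 ≤ 27 * ‖iteratedFDeriv ℝ 2 v x‖ ^ 2 := by
  have h : ∀ l i j, pderiv l (s i j) x ^ 2 ≤ ‖iteratedFDeriv ℝ 2 v x‖ ^ 2 := fun l i j => by
    rw [← sq_abs]; exact pow_le_pow_left₀ (abs_nonneg _) (abs_pderiv_sym_le hv hs l i j x) 2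
  calc ∑ l, ∑ i, ∑ j, pderiv l (s i j) x ^ 2
      ≤ ∑ _l : Fin 3, ∑ _i : Fin 3, ∑ _j : Fin 3, ‖iteratedFDeriv ℝ 2 v x‖ ^ 2 :=
        sum_le_sum fun l _ => sum_le_sum fun i _ => sum_le_sum fun j _ => h l i j
    _ = 27 * ‖iteratedFDeriv ℝ 2 v x‖ ^ 2 := by simp; ring

/-- `√D ≤ 6 ‖D²v‖`. [folklore] -/
theorem sqrt_gradSq_sym_le (hv : ContDiff ℝ ∞ v)
    (hs : ∀ i j y, s i j y = (pderiv j (fun z => v z i) y + pderiv i (fun z => v z j) y) / 2)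
    (x : EuclideanSpace ℝ (Fin 3)) :
    Real.sqrt (∑ l, ∑ i, ∑ j, pderiv l (s i j) x ^ 2) ≤ 6 * ‖iteratedFDeriv ℝ 2 v x‖ := by
  calc Real.sqrt (∑ l, ∑ i, ∑ j, pderiv l (s i j) x ^ 2)
      ≤ Real.sqrt ((6 * ‖iteratedFDeriv ℝ 2 v x‖) ^ 2) :=
        Real.sqrt_le_sqrt (by nlinarith [gradSq_sym_le hv hs x, norm_nonneg (iteratedFDeriv ℝ 2 v x)])
    _ = 6 * ‖iteratedFDeriv ℝ 2 v x‖ := Real.sqrt_sq (by positivity)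

/-- `‖Δv(x)‖ ≤ 6 ‖D²v(x)‖` (`(Δv)ᵢ = Σⱼ ∂ⱼ∂ⱼvᵢ`). [folklore] -/
theorem norm_laplacian_le (hv : ContDiff ℝ ∞ v) (x : EuclideanSpace ℝ (Fin 3)) :
    ‖(Δ v) x‖ ≤ 6 * ‖iteratedFDeriv ℝ 2 v x‖ := by
  set T := ‖iteratedFDeriv ℝ 2 v x‖ with hT
  have hT0 : 0 ≤ T := norm_nonneg _
  have hcomp : ∀ i, |(Δ v) x i| ≤ 3 * T := fun i => by
    rw [laplacian_apply_comp (hv.of_le (by norm_cast)) x i]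
    calc |∑ j, pderiv j (pderiv j fun y => v y i) x|
        ≤ ∑ j, |pderiv j (pderiv j fun y => v y i) x| := abs_sum_le_sum_abs _ _
      _ ≤ ∑ _j : Fin 3, T := sum_le_sum fun j _ => abs_pderiv_grad_le hv i j j x
      _ = 3 * T := by simp
  have hsq : ‖(Δ v) x‖ ^ 2 ≤ (6 * T) ^ 2 := by
    rw [norm_sq_eq_sum_sq]
    calc ∑ i, (Δ v) x i ^ 2 ≤ ∑ _i : Fin 3, (3 * T) ^ 2 := sum_le_sum fun i _ => by
          rw [← sq_abs]; exact pow_le_pow_left₀ (abs_nonneg _) (hcomp i) 2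
      _ = 27 * T ^ 2 := by simp; ring
      _ ≤ (6 * T) ^ 2 := by nlinarith
  have h := abs_le_of_sq_le_sq hsq (by positivity)
  rwa [abs_of_nonneg (norm_nonneg _)] at h

/-- `Δv` is continuous for smooth `v`. [folklore] -/
theorem continuous_laplacian_of (hv : ContDiff ℝ ∞ v) : Continuous (Δ v) := by
  have hv2 : ContDiff ℝ 2 v := hv.of_le (by norm_cast)
  have h : Δ v = fun x => ∑ i, fderiv ℝ (fun y => fderiv ℝ v y (EuclideanSpace.basisFun (Fin 3) ℝ i)) x
      (EuclideanSpace.basisFun (Fin 3) ℝ i) :=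
    funext (laplacian_eq_sum_fderiv_fderiv (EuclideanSpace.basisFun (Fin 3) ℝ) hv2)
  rw [h]
  refine continuous_finsetSum _ fun i _ => ?_
  have hw : ContDiff ℝ ∞ (fun y => fderiv ℝ v y (EuclideanSpace.basisFun (Fin 3) ℝ i)) :=
    ((contDiff_infty_iff_fderiv.1 hv).2).clm_apply contDiff_const
  exact (hw.continuous_fderiv (by simp)).clm_apply continuous_const

/-! ## The pointwise step of the integration by parts -/

/-- **Splitting of `Σᵢⱼ ∂ⱼ(sᵢⱼ N) vᵢ`** for a divergence-free field and a differentiable weight `N`: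
`Σᵢⱼ ∂ⱼ(sᵢⱼN) vᵢ = N · Σᵢ vᵢ (½(Δv)ᵢ) + Σᵢ vᵢ Σⱼ sᵢⱼ ∂ⱼN` (Leibniz and `Σⱼ∂ⱼsᵢⱼ = ½(Δv)ᵢ`).
[folklore] -/
theorem sum_pderiv_mul_weight_eq (hv : ContDiff ℝ ∞ v) (hdiv : VectorCalculus.IsDivFree v)
    (hs : ∀ i j y, s i j y = (pderiv j (fun z => v z i) y + pderiv i (fun z => v z j) y) / 2)
    {N : EuclideanSpace ℝ (Fin 3) → ℝ} (hN : Differentiable ℝ N) (x : EuclideanSpace ℝ (Fin 3)) :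
    ∑ i, ∑ j, pderiv j (fun y => s i j y * N y) x * v x i =
      N x * ∑ i, v x i * ((1 / 2) * (Δ v) x i) + ∑ i, v x i * ∑ j, s i j x * pderiv j N x := by
  have hsd : ∀ i j, Differentiable ℝ (s i j) := fun i j => (contDiff_sym hv hs i j).differentiable (by simp)
  have hdG : ∀ i j, pderiv j (fun y => s i j y * N y) x = pderiv j (s i j) x * N x + s i j x * pderiv j N x :=
    fun i j => by rw [pderiv_mul (hsd i j) hN]
  have hdiv' : ∀ i, ∑ j, pderiv j (s i j) x = (1 / 2) * (Δ v) x i := by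
    intro i
    rw [← sum_pderiv_sym_eq_half_laplacian hv hdiv i x]
    refine Finset.sum_congr rfl fun j _ => ?_
    rw [show s i j = fun y => (pderiv j (fun z => v z i) y + pderiv i (fun z => v z j) y) / 2 from
      funext (hs i j)]
  have e1 : ∀ i, ∑ j, pderiv j (fun y => s i j y * N y) x * v x i =
      N x * (v x i * ∑ j, pderiv j (s i j) x) + v x i * ∑ j, s i j x * pderiv j N x := by
    intro i
    simp only [hdG, Finset.mul_sum, ← Finset.sum_add_distrib]
    exact Finset.sum_congr rfl fun j _ => by ring
  simp only [e1, Finset.sum_add_distrib, ← Finset.mul_sum, hdiv']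

/-- `|Σᵢ vᵢ · (½(Δv)ᵢ)| ≤ ½ ‖v‖ ‖Δv‖`. [folklore] -/
theorem abs_sum_mul_half_laplacian_le (x : EuclideanSpace ℝ (Fin 3)) :
    |∑ i, v x i * ((1 / 2) * (Δ v) x i)| ≤ (1 / 2) * (‖v x‖ * ‖(Δ v) x‖) := by
  set a : EuclideanSpace ℝ (Fin 3) := (Δ v) x with ha
  have hcs := sq_sum_three_mul_le (fun i => v x i) (fun i => (1 / 2) * a i)
  beta_reduce at hcs
  have e1 : ∑ i, (v x i) ^ 2 = ‖v x‖ ^ 2 := (norm_sq_eq_sum_sq (v x)).symm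
  have ea : ‖a‖ ^ 2 = ∑ i, a i ^ 2 := norm_sq_eq_sum_sq a
  have e2 : ∑ i, ((1 / 2) * a i) ^ 2 = (1 / 4) * ‖a‖ ^ 2 := by
    rw [ea, Finset.mul_sum]
    exact Finset.sum_congr rfl fun i _ => by ring
  have h3 : (∑ i, v x i * ((1 / 2) * a i)) ^ 2 ≤ ((1 / 2) * (‖v x‖ * ‖a‖)) ^ 2 := by
    refine hcs.trans_eq ?_
    rw [e1, e2]; ring
  exact abs_le_of_sq_le_sq h3 (by positivity)

/-- `|Σᵢ vᵢ Σⱼ sᵢⱼ zⱼ| ≤ ‖v‖ √q √(Σⱼ zⱼ²)`. [folklore] -/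
theorem abs_sum_mul_sum_mul_le (x : EuclideanSpace ℝ (Fin 3)) (z : Fin 3 → ℝ) :
    |∑ i, v x i * ∑ j, s i j x * z j| ≤
      ‖v x‖ * (Real.sqrt (∑ i, ∑ j, s i j x ^ 2) * Real.sqrt (∑ j, z j ^ 2)) := by
  have hcs := sq_sum_mul_sum_mul_le (fun i j => s i j x) (fun i => v x i) z
  beta_reduce at hcs
  have e1 : ∑ i, (v x i) ^ 2 = ‖v x‖ ^ 2 := (norm_sq_eq_sum_sq (v x)).symm
  rw [e1] at hcs
  have hq0 : 0 ≤ ∑ i, ∑ j, s i j x ^ 2 := sumSq_nonneg (s := s) x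
  have hz0 : 0 ≤ ∑ j, z j ^ 2 := sum_nonneg fun _ _ => sq_nonneg _
  refine abs_le_of_sq_le_sq ?_ (by positivity)
  calc (∑ i, v x i * ∑ j, s i j x * z j) ^ 2 ≤ ‖v x‖ ^ 2 * (∑ i, ∑ j, s i j x ^ 2) * ∑ j, z j ^ 2 := hcs
    _ = (‖v x‖ * (Real.sqrt (∑ i, ∑ j, s i j x ^ 2) * Real.sqrt (∑ j, z j ^ 2))) ^ 2 := by
        rw [mul_pow, mul_pow, Real.sq_sqrt hq0, Real.sq_sqrt hz0]; ring

/-- **The pointwise bound of the cube interpolation.** With `|v| ≤ M`, `0 ≤ N`,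
`Σⱼ (∂ⱼN)² ≤ D`:  `−Σᵢⱼ ∂ⱼ(sᵢⱼN) vᵢ ≤ M (½ N ‖Δv‖ + √q √D)`. [folklore] -/
theorem neg_sum_pderiv_mul_weight_le (hv : ContDiff ℝ ∞ v) (hdiv : VectorCalculus.IsDivFree v)
    (hs : ∀ i j y, s i j y = (pderiv j (fun z => v z i) y + pderiv i (fun z => v z j) y) / 2)
    {N : EuclideanSpace ℝ (Fin 3) → ℝ} (hN : Differentiable ℝ N) {M D : ℝ} (x : EuclideanSpace ℝ (Fin 3))
    (hM : ‖v x‖ ≤ M) (hN0 : 0 ≤ N x) (hD : ∑ j, pderiv j N x ^ 2 ≤ D) :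
    -(∑ i, ∑ j, pderiv j (fun y => s i j y * N y) x * v x i) ≤
      M * ((1 / 2) * (N x * ‖(Δ v) x‖) +
        Real.sqrt (∑ i, ∑ j, s i j x ^ 2) * Real.sqrt D) := by
  rw [sum_pderiv_mul_weight_eq hv hdiv hs hN x]
  have hM0 : 0 ≤ M := (norm_nonneg _).trans hM
  have t1 := abs_sum_mul_half_laplacian_le (v := v) x
  have t2 := abs_sum_mul_sum_mul_le (v := v) (s := s) x (fun j => pderiv j N x)
  have hD0 : 0 ≤ D := (sum_nonneg fun _ _ => sq_nonneg _).trans hD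
  have hsD : Real.sqrt (∑ j, pderiv j N x ^ 2) ≤ Real.sqrt D := Real.sqrt_le_sqrt hD
  have hq0 : 0 ≤ Real.sqrt (∑ i, ∑ j, s i j x ^ 2) := Real.sqrt_nonneg _
  have hL0 : 0 ≤ ‖(Δ v) x‖ := norm_nonneg _
  -- first term
  have a1 : -(N x * ∑ i, v x i * ((1 / 2) * (Δ v) x i)) ≤ M * ((1 / 2) * (N x * ‖(Δ v) x‖)) := by
    have h := neg_abs_le (∑ i, v x i * ((1 / 2) * (Δ v) x i))
    have h2 : N x * |∑ i, v x i * ((1 / 2) * (Δ v) x i)| ≤ N x * ((1 / 2) * (M * ‖(Δ v) x‖)) :=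
      mul_le_mul_of_nonneg_left (t1.trans (by nlinarith)) hN0
    nlinarith
  -- second term
  have a2 : -(∑ i, v x i * ∑ j, s i j x * pderiv j N x) ≤
      M * (Real.sqrt (∑ i, ∑ j, s i j x ^ 2) * Real.sqrt D) := by
    have h := neg_abs_le (∑ i, v x i * ∑ j, s i j x * pderiv j N x)
    have h2 : ‖v x‖ * (Real.sqrt (∑ i, ∑ j, s i j x ^ 2) * Real.sqrt (∑ j, pderiv j N x ^ 2)) ≤
        M * (Real.sqrt (∑ i, ∑ j, s i j x ^ 2) * Real.sqrt D) :=
      mul_le_mul hM (mul_le_mul_of_nonneg_left hsD hq0) (by positivity) hM0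
    linarith [t2]
  rw [neg_add, mul_add]
  exact add_le_add a1 a2

end Summit.NavierStokesRegularity.NavierStokesRegularity.Theorems.DepletionLadder.StrainCube

end
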